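import Literature.AlgebraicGeometry.Resolution.EffectiveDivisorIdealSheafProduct
import Literature.AlgebraicGeometry.Resolution.CartierDivisorExcCurveH0
import Literature.AlgebraicGeometry.Resolution.ExceptionalCurvePoints
import Literature.AlgebraicGeometry.Resolution.BirationalStalkStructureMap
import Literature.AlgebraicGeometry.Motives.CartierDivisorSameDivisorOfOrdAt
import Literature.AlgebraicGeometry.Motives.CartierDivisorEffectiveOfOrdAt
import Literature.AlgebraicGeometry.Motives.CartierDivisorSameDivisorIdealSheaf
import Literature.AlgebraicGeometry.Motives.CartierDivisorMultiplicityOfIrreducibleSupport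
import Literature.AlgebraicGeometry.Motives.CurveSignedFamilies
import HarnessLib

/-!
# Moving an exceptional curve by a principal divisor: `(g) = 𝓘_E^a · 𝓗`, `(H·E) = −a(E·E)`
# (Lipman 1969, §13–§14; Mumford 1961)

Topic: `Literature/AlgebraicGeometry/Resolution`.  PROVED, fact-free, definition-free.  On a resolution
`π : X → Spec T` of a two-dimensional Noetherian local domain, a global function `g ∈ Γ(X, 𝒪_X)` vanishing to
order `a = ord_E(g)` along an integral exceptional curve `E = E_η` has principal divisor `div g = aE + H` with `H`
effective and `E ⊄ H` (unique factorisation on the regular `X`), whence `𝒪_X · g = 𝓘_E^a · 𝓗` as ideal sheaves,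
`𝓗 ∩ 𝓘_E = 𝓗𝓘_E`, `E ∩ H` finite, and — since `(div g · E) = 0` — `(H·E) = h⁰(𝒪_{E∩H}) = −a·(E·E)` (J. Lipman,
*Rational singularities …*, Publ. Math. IHÉS 36 (1969), §12 Remark 2 c) p. 221, §13 p. 223, §14 p. 224:
"`e·div(π^*f) ∼ D' + Σ bⱼ Eⱼ`"; D. Mumford, Publ. Math. IHÉS 9 (1961) p. 6).  This is the geometric input of the
self-intersection step `χ(𝒪_E(−L−E)) = χ(𝒪_E(−L)) − (E·E)` of the conormal-degree computation (Prop. (13.1) b), d)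
in `h⁰`-form for repeated curves).

* `mem_nonZeroDivisors_map_of_secFn_ne_zero` — a global function `≠ 0` in `K(X)` restricts to non-zero-divisors;
* `exists_secFn_ord_eq_add_one` — base functions `g₁`, `g₂` with `ord_E(g₂) = ord_E(g₁) + 1` (`K(X) = Frac T`);
* **`exists_moving_ideal`** — the factorisation `(g) = 𝓘_E^a 𝓗` with all the side data and `(H·E) = −a(E·E)`.

## References
* J. Lipman, Publ. Math. IHÉS 36 (1969), §12 Remark 2 c) (p. 221), §13 (p. 223), §14 (p. 224). [Lipman1969]
* U. Görtz, T. Wedhorn, *Algebraic Geometry I* (2nd ed. 2020), Thm. 11.40, Remark 11.27. [GortzWedhorn2020]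
-/

noncomputable section

open CategoryTheory AlgebraicGeometry TopologicalSpace IsLocalRing Opposite Order
open Literature.AlgebraicGeometry.Motives Literature.AlgebraicGeometry.Motives.RatFn
open Literature.AlgebraicGeometry.Morphisms
open Scheme.IdealSheafData

universe u

namespace Literature.AlgebraicGeometry.Resolution

/-! ## §1 Global functions restrict to non-zero-divisors -/

/-- A global function on an integral scheme which is non-zero in `K(X)` restricts to a non-zero-divisor on every
affine open (a domain when non-empty, the zero ring when empty). [cite: GortzWedhorn2020, Prop. 3.29 (p. 102)] -/
theorem mem_nonZeroDivisors_map_of_secFn_ne_zero {X : Scheme.{u}} [IsIntegral X] (γ : Γ(X, ⊤))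
    (hγ : secFn (show genericPoint X ∈ (⊤ : X.Opens) from trivial) γ ≠ 0) (V : X.affineOpens) :
    X.presheaf.map (homOfLE (le_top : (V : X.Opens) ≤ ⊤)).op γ ∈ nonZeroDivisors Γ(X, V) := by
  rcases (V : X.Opens).1.eq_empty_or_nonempty with h | h
  · have hbot : (V : X.Opens) = ⊥ := SetLike.ext' h
    haveI : Subsingleton Γ(X, (V : X.Opens)) :=
      CommRingCat.subsingleton_of_isTerminal (X.sheaf.isTerminalOfEqEmpty hbot)
    exact ⟨fun x _ => Subsingleton.elim _ _, fun x _ => Subsingleton.elim _ _⟩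
  · obtain ⟨y, hy⟩ := h
    have hy' : y ∈ (V : X.Opens) := hy
    haveI : Nonempty (V : X.Opens) := ⟨⟨y, hy'⟩⟩
    refine mem_nonZeroDivisors_of_ne_zero fun h0 => hγ ?_
    rw [← secFn_map (le_top : (V : X.Opens) ≤ ⊤) hy' γ, h0, secFn_zero]

/-! ## §2 Base functions with consecutive orders along `E` -/

section Orders

variable {T : Type u} [CommRing T] [IsDomain T] {X : Scheme.{u}} [IsIntegral X] [IsLocallyNoetherian X]
  (π : X ⟶ Spec (.of T))

/-- **Two global functions with consecutive orders along `E`**: on `X` regular, birational over the domain `T`,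
for a codimension-one point `η` there are global functions `g₁`, `g₂` (pulled back from `T`), non-zero in `K(X)`,
with `ord_η(g₂) = ord_η(g₁) + 1` (write a uniformiser of the discrete valuation ring `𝒪_{X,η}` as a quotient
`a/b` of base functions, `K(X) = Frac T`). [cite: Lipman1969, Section 14 (p. 224)] -/
theorem exists_secFn_ord_eq_add_one (hπ : IsBirational π) (hX : Scheme.IsRegular X) {η : X}
    (hco : coheight η = 1) (hE : IsEffectiveCartier (primeDivisorIdeal η)) :
    ∃ γ₁ γ₂ : Γ(X, ⊤),
      ∃ (_ : secFn (show genericPoint X ∈ (⊤ : X.Opens) from trivial) γ₁ ≠ 0)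
        (_ : secFn (show genericPoint X ∈ (⊤ : X.Opens) from trivial) γ₂ ≠ 0),
        Scheme.ord (secFn (show genericPoint X ∈ (⊤ : X.Opens) from trivial) γ₂) η =
          Scheme.ord (secFn (show genericPoint X ∈ (⊤ : X.Opens) from trivial) γ₁) η + 1 := by
  -- a uniformiser: the local equation of `E` at `η`
  set E := CartierDivisor.ofIsEffectiveCartier (primeDivisorIdeal η) hE with hEdef
  obtain ⟨i, hi⟩ := E.covers η
  have hord : Scheme.ord (E.f i) η = 1 := by
    rw [← E.ordAt_eq_ord hi, hEdef, ordAt_ofIsEffectiveCartier_primeDivisorIdeal_self hX hco hE]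
  -- write it as a quotient of base functions
  obtain ⟨a, b, hb, hab⟩ := exists_eq_div_germ_algebraMapΓ π hπ η (E.f i)
  have hsec : ∀ t : T, algebraMap (X.presheaf.stalk η) X.functionField
      (((X.presheaf.germ ⊤ η trivial).hom.comp (Morphisms.algebraMapΓ π)) t) =
      secFn (show genericPoint X ∈ (⊤ : X.Opens) from trivial) (Morphisms.algebraMapΓ π t) := fun t =>
    toFunctionField_germ_eq_secFn (show genericPoint X ∈ (⊤ : X.Opens) from trivial) trivial _
  rw [hsec, hsec] at hab
  set φa := secFn (show genericPoint X ∈ (⊤ : X.Opens) from trivial) (Morphisms.algebraMapΓ π a) with hφa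
  set φb := secFn (show genericPoint X ∈ (⊤ : X.Opens) from trivial) (Morphisms.algebraMapΓ π b) with hφb
  have hφb0 : φb ≠ 0 := by
    intro h0
    apply hb
    apply toFunctionField_injective η
    rw [map_zero]
    change algebraMap (X.presheaf.stalk η) X.functionField _ = 0
    rw [hsec, ← hφb, h0]
  have hφa0 : φa ≠ 0 := by
    intro h0
    rw [h0, zero_div] at hab
    exact E.f_ne_zero i hab
  refine ⟨Morphisms.algebraMapΓ π b, Morphisms.algebraMapΓ π a, hφb0, hφa0, ?_⟩
  change Scheme.ord φa η = Scheme.ord φb η + 1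
  have e : φa = E.f i * φb := by rw [hab, div_mul_cancel₀ _ hφb0]
  rw [e, Scheme.ord_mul (E.f_ne_zero i) hφb0, hord, add_comm]

end Orders

/-! ## §3 The moving lemma -/

section Moving

variable {T : Type u} [CommRing T] [IsNoetherianRing T] [IsLocalRing T] [IsDomain T]
  {X : Scheme.{u}} [IsIntegral X] [IsLocallyNoetherian X] {π : X ⟶ Spec (.of T)}

/-- **Moving lemma `(g) = 𝓘_E^a · 𝓗`, `(H·E) = −a(E·E)`.**  Let `π : X → Spec T` be a resolution of a
two-dimensional Noetherian local domain, `E = E_η` an integral exceptional curve (`𝓘_E = primeDivisorIdeal η`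
invertible) and `g ∈ Γ(X, 𝒪_X)` a global function, non-zero in `K(X)`, with `a := ord_η(g)`.  Then there is an
invertible ideal sheaf `𝓗` (the ideal of the effective divisor `H = div g − aE`) with: `η ∉ V(𝓗)`;
`𝓗 ∩ 𝓘_E ⊆ 𝓗𝓘_E`; `𝓘_E^a 𝓗 = (g)` on every affine open; `V(𝓗 + 𝓘_E) ⊆ Z` for a finite set `Z` of closed points;
`h⁰(𝒪_X/(𝓗+𝓘_E))` finite and equal to `−a·(E·E)` (`(div g·E) = 0`, `(H·E) = h⁰(𝒪_{E∩H})`, Lipman §12 Remark 2 c)).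
[cite: Lipman1969, Section 14 (p. 224) with Section 12 Remark 2 c) (p. 221)] [cite: GortzWedhorn2020, Thm. 11.40] -/
theorem exists_moving_ideal (hdim : ringKrullDim T = 2) (hπ : IsResolution π) {η : X}
    (hη : η ∈ excCurvePoints π) (hE : IsEffectiveCartier (primeDivisorIdeal η)) (γ : Γ(X, ⊤))
    (hγ : secFn (show genericPoint X ∈ (⊤ : X.Opens) from trivial) γ ≠ 0) :
    ∃ (𝓗 : X.IdealSheafData) (a : ℕ) (Z : Set X), IsEffectiveCartier 𝓗 ∧ η ∉ 𝓗.support ∧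
      𝓗 ⊓ primeDivisorIdeal η ≤ 𝓗 * primeDivisorIdeal η ∧
      (∀ V : X.affineOpens, (primeDivisorIdeal η ^ a * 𝓗).ideal V =
        Ideal.span {X.presheaf.map (homOfLE (le_top : (V : X.Opens) ≤ ⊤)).op γ}) ∧
      Z.Finite ∧ (∀ p ∈ Z, IsClosed ({p} : Set X)) ∧ (((𝓗 ⊔ primeDivisorIdeal η).support : Set X) ⊆ Z) ∧
      h0 π (𝓗 ⊔ primeDivisorIdeal η) ≠ ⊤ ∧
      ((h0 π (𝓗 ⊔ primeDivisorIdeal η)).toNat : ℤ) =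
        -(a * excCurveDegree π (CartierDivisor.ofIsEffectiveCartier (primeDivisorIdeal η) hE) η) ∧
      (a : ℤ) = Scheme.ord (secFn (show genericPoint X ∈ (⊤ : X.Opens) from trivial) γ) η := by
  haveI : IsProper π := hπ.isProper
  haveI : IsNoetherian X := by
    haveI : CompactSpace X := QuasiCompact.compactSpace_of_compactSpace π
    exact {}
  have hX : Scheme.IsRegular X := hπ.isRegular
  have hco : coheight η = 1 := hπ.coheight_eq_one_of_mem_excCurvePoints hdim hη
  -- the divisors `P = div g`, `E`, `D' = P − aE`
  set φ := secFn (show genericPoint X ∈ (⊤ : X.Opens) from trivial) γ with hφ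
  set P := CartierDivisor.principal φ hγ with hPdef
  have hPeff : P.IsEffective := isEffective_principal_secFn γ hγ
  set E := CartierDivisor.ofIsEffectiveCartier (primeDivisorIdeal η) hE with hEdef
  have hEeff : E.IsEffective := CartierDivisor.isEffective_ofIsEffectiveCartier _ hE
  have hEord : E.ordAt η = 1 := ordAt_ofIsEffectiveCartier_primeDivisorIdeal_self hX hco hE
  have hPord : 0 ≤ P.ordAt η := hPeff.ordAt_nonneg η
  set a : ℕ := (P.ordAt η).toNat with hadef
  have haZ : (a : ℤ) = P.ordAt η := Int.toNat_of_nonneg hPord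
  set D' : CartierDivisor X := P + -(a • E) with hD'def
  have hD'ord : ∀ z : X, D'.ordAt z = P.ordAt z - a * E.ordAt z := fun z => by
    rw [hD'def, CartierDivisor.ordAt_add, CartierDivisor.ordAt_neg, CartierDivisor.ordAt_smul]
    ring
  -- distinct codimension-one points do not specialise to one another
  have hnsp : ∀ z : X, coheight z = 1 → z ≠ η → ¬ η ⤳ z := by
    intro z hz hne hsp
    have hlt : z < η := ⟨Scheme.le_iff_specializes.2 hsp,
      fun h' => hne (((Scheme.le_iff_specializes.1 h').antisymm hsp).eq)⟩
    have h1 := Order.coheight_add_one_le hlt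
    rw [hz, hco] at h1
    exact absurd h1 (by decide)
  have hEoff : ∀ z : X, coheight z = 1 → z ≠ η → E.ordAt z = 0 := fun z hz hne =>
    ((CartierDivisor.avoids_ofIsEffectiveCartier_iff _ hE z).2
      (by rw [mem_support_primeDivisorIdeal_iff]; exact hnsp z hz hne)).ordAt_eq_zero
  have hD'η : D'.ordAt η = 0 := by rw [hD'ord, hEord, mul_one, ← haZ, sub_self]
  have hD'eff : D'.IsEffective := by
    refine CartierDivisor.isEffective_of_forall_ordAt_nonneg hX fun z hz => ?_
    by_cases hzη : z = η
    · rw [hzη, hD'η]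
    · rw [hD'ord, hEoff z hz hzη, mul_zero, sub_zero]
      exact hPeff.ordAt_nonneg z
  set 𝓗 : X.IdealSheafData := hD'eff.idealSheaf with h𝓗
  have hHc : IsEffectiveCartier 𝓗 := hD'eff.isEffectiveCartier_idealSheaf
  -- `η ∉ V(𝓗)`: `D'` avoids `η` (order `0` at a codimension-one point of the regular `X`)
  have hD'av : D'.Avoids η := by
    intro j hj
    have hreg : IsRegularAt η (D'.f j) := hD'eff j η hj
    have h0 : Scheme.ord (D'.f j) η = 0 := by rw [← D'.ordAt_eq_ord hj, hD'η]
    exact isUnitAt_of_ord_eq_zero hco (hX η) (D'.f_ne_zero j) h0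
  have hηH : η ∉ 𝓗.support := fun h => (hD'eff.mem_support_idealSheaf_iff.mp h) hD'av
  -- `𝓘_E^a 𝓗 = (g)`
  have hfac : primeDivisorIdeal η ^ a * 𝓗 = hPeff.idealSheaf := by
    have hsame : (a • E + D').SameDivisor P := by
      refine CartierDivisor.sameDivisor_of_forall_ordAt_eq hX fun z _ => ?_
      rw [CartierDivisor.ordAt_add, CartierDivisor.ordAt_smul, hD'ord]
      ring
    have h1 : ((hEeff.smul a).add hD'eff).idealSheaf = hPeff.idealSheaf := hsame.idealSheaf_eq _ hPeff
    have e3 : (hEeff.smul a).idealSheaf = primeDivisorIdeal η ^ a := by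
      rw [hEeff.idealSheaf_smul]
      congr 1
      exact CartierDivisor.idealSheaf_ofIsEffectiveCartier (primeDivisorIdeal η) hE
    rw [idealSheaf_add_of_isEffective (hEeff.smul a) hD'eff, e3] at h1
    exact h1
  have hspan : ∀ V : X.affineOpens, (primeDivisorIdeal η ^ a * 𝓗).ideal V =
      Ideal.span {X.presheaf.map (homOfLE (le_top : (V : X.Opens) ≤ ⊤)).op γ} := fun V => by
    rw [hfac]
    exact ideal_idealSheaf_principal_eq_span γ hγ V
  -- the finite set `E ∩ H`
  set Z : Set X := closure ({η} : Set X) ∩ (𝓗.support : Set X) with hZ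
  have hZfin : Z.Finite := finite_closure_inter_of_notMem hη.2.le 𝓗.support.isClosed hηH
  have hZcl : ∀ p ∈ Z, IsClosed ({p} : Set X) := fun p hp =>
    isClosed_singleton_of_specializes_of_ne hη.2.le (specializes_iff_mem_closure.2 hp.1) (fun e => hηH (e ▸ hp.2))
  have hsupp : (((𝓗 ⊔ primeDivisorIdeal η).support : Set X)) ⊆ Z := by
    intro x hx
    have h1 : x ∈ (𝓗.support : Set X) := support_antitone (le_sup_left : 𝓗 ≤ 𝓗 ⊔ primeDivisorIdeal η) hx
    have h2 : x ∈ ((primeDivisorIdeal η).support : Set X) :=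
      support_antitone (le_sup_right : primeDivisorIdeal η ≤ 𝓗 ⊔ primeDivisorIdeal η) hx
    rw [coe_support_primeDivisorIdeal] at h2
    exact ⟨h2, h1⟩
  -- `h0(𝓗 + 𝓘_E) = (H·E) = (div g·E) − a(E·E) = −a(E·E)`
  obtain ⟨hfin, hnum⟩ := toNat_h0_sup_eq_excCurveDegree_of_notMem_support (π := π) hη 𝓗 hHc hηH
  have hHD' : (CartierDivisor.ofIsEffectiveCartier 𝓗 hHc).SameDivisor D' :=
    CartierDivisor.SameDivisor.of_idealSheaf_eq (CartierDivisor.isEffective_ofIsEffectiveCartier 𝓗 hHc) hD'eff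
      (CartierDivisor.idealSheaf_ofIsEffectiveCartier 𝓗 hHc)
  have hdeg : excCurveDegree π (CartierDivisor.ofIsEffectiveCartier 𝓗 hHc) η = -(a * excCurveDegree π E η) := by
    rw [excCurveDegree_congr_linEquiv π hη hHD'.linEquiv, hD'def, excCurveDegree_add π hη,
      excCurveDegree_neg π hη, excCurveDegree_smul π hη, hPdef, excCurveDegree_principal π hη, zero_add]
  refine ⟨𝓗, a, Z, hHc, hηH, inf_primeDivisorIdeal_le_mul_of_notMem_support 𝓗 hHc hηH, hspan, hZfin, hZcl,
    hsupp, ?_, ?_, ?_⟩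
  · rw [sup_comm]; exact hfin
  · rw [sup_comm, hnum, hdeg]
  · rw [haZ, hPdef, CartierDivisor.ordAt_principal]

end Moving

end Literature.AlgebraicGeometry.Resolution

end
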